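import Mathlib
import Literature.NumberTheory.ModularForms.SturmCongruence
import Summits.Langlands.Langlands.Theorems.CapacityClassicalityIntegralOverconvergentIsCongruenceStubSupNormOfSturm
import Summits.Langlands.Langlands.Theorems.CapacityClassicalityHilbertIntegralOverconvergentIsCongruenceStubEisensteinCoeff
import Summits.Langlands.Langlands.Theorems.CapacityClassicalityHilbertIntegralOverconvergentIsCongruenceStubCoeffMulBound
import Summits.Langlands.Langlands.Theorems.CapacityClassicalityHilbertIntegralOverconvergentIsCongruenceStubCoeffInvBound
import Summits.Langlands.Langlands.Theorems.CapacityClassicalityHilbertIntegralOverconvergentIsCongruenceStubKatzTruncationModular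
import Summits.Langlands.Langlands.Theorems.CapacityClassicalityHilbertIntegralOverconvergentIsCongruenceStubModularSupNormOfCusp
import Summits.Langlands.Langlands.Theorems.CapacityClassicalityHilbertIntegralOverconvergentIsCongruenceStubShadowMainGeneral
import Summits.Langlands.Langlands.Theorems.CapacityClassicalityHilbertIntegralOverconvergentIsCongruenceStubSturmModPrimeLevelOne

/-!
# Crux `HilbertIntegralOverconvergentIsCongruence` (stmt-Langlands-8485), line `Sketch-ideate-r1-k1`:
# the ENDPOINT of the `d = 1` shadow (Sturm–Schwarz `p`-adic lemma at the cusp, cusp-form route)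

This file assembles the landed stubs of the line into its registered endpoint
`sturmSchwarzShadowCusp_of_sturmModPrime_at` (stub 12 of the skeleton
`Cruxes/HilbertIntegralOverconvergentIsCongruence/Lines/Sketch_ideate_r1_k1.lean`): for a prime `p ≥ 5`
and a level `N`, Sturm's congruence bound mod `p` over `ℤ` for `S_•(Γ₁(N))` (the ONE named fact of the
line, `Literature.NumberTheory.ModularForms.Sturm1987_congruence_modPrime_gamma1`, here a hypothesis at
this `(N, p)`) implies the shadow: a Katz surrogate `g = Σ_i ι⁻¹(c_i · E_{p-1}^{-i})` on `Γ₁(N)` with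
`‖ι⁻¹ c_i‖ ≤ C p^{-ri}` whose `q`-expansion vanishes to order `m` has
`‖g_m‖ ≤ C · p^{-r(M+1)}` for every `M` with `⌊(12 + k + M(p-1)) · [SL₂(ℤ):Γ₁(N)] / 12⌋ ≤ m`.

Chain: Sturm mod `p` over `ℤ` (hypothesis) ⇒ sup-norm Sturm along `ι` for cusp forms (sibling line,
`CapacityClassicality.stub_supNormOfSturm`, Deligne–Serre integral span, PROVED) ⇒ the same for modular
forms with the `Δ`-shifted line (`stub_modularSupNormOfCusp`) ⇒ the three-line Katz-truncation argument
with that line (`sturmSchwarzShadow_of_sturmLine`), fed the elementary inputs `stub_eisensteinCoeff`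
(von Staudt–Clausen), `stub_coeffMulBound`, `stub_coeffInvBound` (ultrametric power-series bounds) and
`stub_katzTruncationModular`.

Consequences recorded here:
* `sturmSchwarzShadowCusp_of_Sturm1987` — the shadow for every `N` with `p ∤ N`, CONDITIONAL on the
  named fact `Sturm1987_congruence_modPrime_gamma1` (Sturm 1987, Thm 1) and on nothing else;
* `sturmSchwarzShadowCusp_levelOne` — the level-one case `N = 1`, UNCONDITIONAL (the named fact is
  discharged at level one by `stub_sturmModPrimeLevelOne`): the route's own sanity case (`p = 5`,
  level `1`, gain `3 r log 5` per unit order of vanishing).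

Theorems only, no definitions, no `sorry`.
-/

set_option linter.dupNamespace false

noncomputable section

open scoped MatrixGroups

namespace Summit.Langlands.Langlands.Theorems.HilbertIntegralOverconvergentIsCongruence

/-- **Endpoint of line `Sketch-ideate-r1-k1` (registered stub 12,
`sturmSchwarzShadowCusp_of_sturmModPrime_at`).**  For `p ≥ 5` prime and a level `N`: Sturm's
congruence bound mod `p` over `ℤ` for cusp forms on `Γ₁(N)` at this `(N, p)` implies the `d = 1`
Sturm–Schwarz shadow with the `Δ`-shifted Sturm line — a Katz surrogate
`g_n = Σ_i ι⁻¹ coeff_n (c_i · E_{p-1}^{-i})` (`c_i` the `q`-expansion of a form of weight `k + i(p-1)`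
on `Γ₁(N)`, `‖ι⁻¹ c_i‖ ≤ C p^{-ri}`) vanishing to order `m` satisfies `‖g_m‖ ≤ C · p^{-r(M+1)}`
whenever `⌊(12 + k + M(p-1)) · [SL₂(ℤ):Γ₁(N)] / 12⌋ ≤ m`. [folklore] -/
theorem sturmSchwarzShadowCusp_of_sturmModPrime_at :
    ∀ (p : ℕ) [Fact p.Prime] (hp : 5 ≤ p) (N : ℕ) [NeZero N],
      (∀ (k : ℤ) (f : CuspForm (CongruenceSubgroup.Gamma1 N) k) (z : ℕ → ℤ),
        (∀ n : ℕ, PowerSeries.coeff n (UpperHalfPlane.qExpansion 1 ⇑f) = (z n : ℂ)) →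
        (∀ n : ℕ, n ≤ (k * ((CongruenceSubgroup.Gamma1 N).index : ℤ)).toNat / 12 → (p : ℤ) ∣ z n) →
        ∀ n : ℕ, (p : ℤ) ∣ z n) →
      ∀ (k : ℤ) (ι : PadicAlgCl p ≃+* ℂ) (r C : ℝ) (c : ℕ → PowerSeries ℂ), 0 < r → 0 ≤ C →
      (∀ i : ℕ, ∃ F : ModularForm (CongruenceSubgroup.Gamma1 N) (k + i * (p - 1 : ℕ)),
          c i = UpperHalfPlane.qExpansion 1 ⇑F) →
      (∀ i n : ℕ, ‖ι.symm (PowerSeries.coeff n (c i))‖ ≤ C * (p : ℝ) ^ (-(r * i))) →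
      ∀ (g : ℕ → PadicAlgCl p),
      (∀ n : ℕ, HasSum (fun i : ℕ ↦ ι.symm (PowerSeries.coeff n (c i *
          ((UpperHalfPlane.qExpansion 1 ⇑(ModularForm.E (show 3 ≤ p - 1 by omega)))⁻¹) ^ i)))
          (g n)) →
      ∀ (m M : ℕ), (∀ n < m, g n = 0) →
        ((12 + (k + M * (p - 1 : ℕ))) * ((CongruenceSubgroup.Gamma1 N).index : ℤ)).toNat / 12 ≤ m →
        ‖g m‖ ≤ C * (p : ℝ) ^ (-(r * (M + 1 : ℕ))) := by
  intro p _ hp N _ hSturm k ι r C c hr hC hc hb g hg m M hvan hline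
  have hSup := CapacityClassicality.stub_supNormOfSturm p N hSturm ι
  exact sturmSchwarzShadow_of_sturmLine p hp N k ι
    (fun k' ↦ ((12 + k') * ((CongruenceSubgroup.Gamma1 N).index : ℤ)).toNat / 12)
    (fun k' F B hB hF ↦ stub_modularSupNormOfCusp p N ι hSup k' F B hB hF)
    (stub_eisensteinCoeff p hp ι) (stub_coeffMulBound p) (stub_coeffInvBound p)
    (stub_katzTruncationModular p hp N k) r C c hr hC hc hb g hg m M hvan hline

/-- **The `d = 1` shadow for every level prime to `p`, conditional on ONE named fact.**  Sturm's
congruence bound mod `p` over `ℤ` for `Γ₁(N)` (Sturm 1987, Thm 1; the tree's named fact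
`Literature.NumberTheory.ModularForms.Sturm1987_congruence_modPrime_gamma1`, UNPROVED there, taken as
the hypothesis `hSturm`) implies: for `p ≥ 5` prime, `p ∤ N`, every Katz surrogate on `Γ₁(N)` of rate
`r` and constant `C` vanishing to order `m` has `‖g_m‖ ≤ C · p^{-r(M+1)}` whenever
`⌊(12 + k + M(p-1)) · [SL₂(ℤ):Γ₁(N)] / 12⌋ ≤ m`.  This is verbatim the line's registered endpoint
statement `SketchIdeateR1K1.SturmSchwarzShadowCuspQ`, conditional on the named fact (the gate records
a `conditional-result`). [folklore] -/
theorem sturmSchwarzShadowCusp_of_Sturm1987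
    (hSturm : Literature.NumberTheory.ModularForms.Sturm1987_congruence_modPrime_gamma1) :
    ∀ (p : ℕ) [Fact p.Prime] (hp : 5 ≤ p) (N : ℕ) [NeZero N], ¬ p ∣ N →
      ∀ (k : ℤ) (ι : PadicAlgCl p ≃+* ℂ) (r C : ℝ) (c : ℕ → PowerSeries ℂ), 0 < r → 0 ≤ C →
      (∀ i : ℕ, ∃ F : ModularForm (CongruenceSubgroup.Gamma1 N) (k + i * (p - 1 : ℕ)),
          c i = UpperHalfPlane.qExpansion 1 ⇑F) →
      (∀ i n : ℕ, ‖ι.symm (PowerSeries.coeff n (c i))‖ ≤ C * (p : ℝ) ^ (-(r * i))) →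
      ∀ (g : ℕ → PadicAlgCl p),
      (∀ n : ℕ, HasSum (fun i : ℕ ↦ ι.symm (PowerSeries.coeff n (c i *
          ((UpperHalfPlane.qExpansion 1 ⇑(ModularForm.E (show 3 ≤ p - 1 by omega)))⁻¹) ^ i)))
          (g n)) →
      ∀ (m M : ℕ), (∀ n < m, g n = 0) →
        ((12 + (k + M * (p - 1 : ℕ))) * ((CongruenceSubgroup.Gamma1 N).index : ℤ)).toNat / 12 ≤ m →
        ‖g m‖ ≤ C * (p : ℝ) ^ (-(r * (M + 1 : ℕ))) :=
  fun p _ hp N _ hpN k ι r C c hr hC hc hb g hg m M hvan hline ↦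
    sturmSchwarzShadowCusp_of_sturmModPrime_at p hp N
      (fun k' f z hz hdiv ↦
        Literature.NumberTheory.ModularForms.Sturm1987_congruence_modPrime_gamma1.cuspForm hSturm N p
          Fact.out hpN k' f z hz hdiv)
      k ι r C c hr hC hc hb g hg m M hvan hline

/-- **The `d = 1`, level-one shadow, UNCONDITIONAL.**  For `p ≥ 5` prime, every Katz surrogate on
`Γ₁(1) = SL₂(ℤ)` of rate `r` and constant `C` (`g_n = Σ_i ι⁻¹ coeff_n (c_i · E_{p-1}^{-i})`, `c_i` the
`q`-expansion of a level-one form of weight `k + i(p-1)`, `‖ι⁻¹ c_i‖ ≤ C p^{-ri}`) whose `q`-expansion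
vanishes to order `m` satisfies `‖g_m‖ ≤ C · p^{-r(M+1)}` whenever
`⌊(12 + k + M(p-1)) · [SL₂(ℤ):Γ₁(1)] / 12⌋ ≤ m` — Sturm's bound mod `p` being a THEOREM of the tree
at level one (`stub_sturmModPrimeLevelOne`).  Numbers: `p = 5`, `N = 1`, `μ = 1`: vanishing to order
`m` gives `M = ⌊(12m - 12 - k)/4⌋`, i.e. a gain of `3 r log 5` per unit order, the route's capacity
number at level one, with no potential theory. [folklore] -/
theorem sturmSchwarzShadowCusp_levelOne :
    ∀ (p : ℕ) [Fact p.Prime] (hp : 5 ≤ p) (k : ℤ) (ι : PadicAlgCl p ≃+* ℂ) (r C : ℝ)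
      (c : ℕ → PowerSeries ℂ), 0 < r → 0 ≤ C →
      (∀ i : ℕ, ∃ F : ModularForm (CongruenceSubgroup.Gamma1 1) (k + i * (p - 1 : ℕ)),
          c i = UpperHalfPlane.qExpansion 1 ⇑F) →
      (∀ i n : ℕ, ‖ι.symm (PowerSeries.coeff n (c i))‖ ≤ C * (p : ℝ) ^ (-(r * i))) →
      ∀ (g : ℕ → PadicAlgCl p),
      (∀ n : ℕ, HasSum (fun i : ℕ ↦ ι.symm (PowerSeries.coeff n (c i *
          ((UpperHalfPlane.qExpansion 1 ⇑(ModularForm.E (show 3 ≤ p - 1 by omega)))⁻¹) ^ i)))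
          (g n)) →
      ∀ (m M : ℕ), (∀ n < m, g n = 0) →
        ((12 + (k + M * (p - 1 : ℕ))) * ((CongruenceSubgroup.Gamma1 1).index : ℤ)).toNat / 12 ≤ m →
        ‖g m‖ ≤ C * (p : ℝ) ^ (-(r * (M + 1 : ℕ))) :=
  fun p _ hp k ι r C c hr hC hc hb g hg m M hvan hline ↦
    sturmSchwarzShadowCusp_of_sturmModPrime_at p hp 1
      (fun k' f z hz hdiv ↦ stub_sturmModPrimeLevelOne p Fact.out k' f z hz hdiv)
      k ι r C c hr hC hc hb g hg m M hvan hline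

end Summit.Langlands.Langlands.Theorems.HilbertIntegralOverconvergentIsCongruence

end
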